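import Summits.Ventures.HSemireg.HomComplexSigmaQuasiIso
import Summits.Ventures.HSemireg.PerfectComplexSigmaDoor
import HarnessLib

/-!
# The semiregularity admissibility notion is model-independent along quasi-isomorphisms of strictly perfect complexes

Cell `pub-hsemireg`, general-structure seat gs-g4 (gen 18); sequel to `HomComplexSigmaQuasiIso.lean` ((I6-qis)).  HONEST FRAMING:
kernel plumbing on real carriers — NOT a door, NOT a named fact, NOT a «K2 result»; nothing here says HC, HC_CM or HC_AV is proved.

* §1 WINDOW INDEPENDENCE: t-7's unit `𝒪_X[0] ⟶ 𝓗om•(K•, K•)` (`HomComplex.unit X K a b`), hence `σ_q` (`HomComplex.sigmaC X K a b hK q`)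
  and the predicates `IsISemiregularC` / `IsSemiregularC`, do not depend on the amplitude window `[a, b]` chosen for `K•`
  (`unit_eq_of_window`, `sigmaC_eq_of_window`, `isISemiregularC_iff_of_window`): the unit is the sum of `a ↦ a · 𝟙_{K^p}` over the
  window, and the summands outside the support of `K•` vanish.
* §2 TRANSPORT ALONG QUASI-ISOMORPHISMS WITH INDEPENDENT WINDOWS: `sigmaC_eq_of_quasiIso'`, `isISemiregularC_iff_of_quasiIso'`
  (`HomComplexSigmaQuasiIso.lean` through the common window `[min a₁ a₂, max b₁ b₂]`).
* §3 **`sigmaAdmissible_iff_of_quasiIso`**: for a quasi-isomorphism `f : E ⟶ E'` between strictly perfect complexes on a `ℂ`-scheme `X₀`,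
  `sigmaAdmissible n X₀ I E ↔ sigmaAdmissible n X₀ I E'` — the object hypothesis of the σ-door (`PerfectComplexSigmaDoor.lean`, seat t-7:
  `{1..n} ⊆ I`, `Ext^{<0}(E,E) = 0`, `Hom(E,E) = ℂ`, `(σ_q)_{q+1 ∈ I}` jointly injective) depends only on the quasi-isomorphism class of the
  strictly perfect model, as [BF03] §5 / [Pridham2024] Cor. 2.25 state it for the object of `D^b(X₀)` (the `Ext`-rank clauses by p4's
  `extRank_eq_of_quasiIso`, `PerfectComplexRankDoor.lean`); and `sigmaAdmissible_iff_of_roof`.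

## References
* R.-O. Buchweitz, H. Flenner, *A semiregularity map for modules and applications to deformations*, Compositio Math. 137 (2003),
  Def. 4.1 and §5. [BuchweitzFlenner2003]
-/

noncomputable section

open CategoryTheory CategoryTheory.Limits CategoryTheory.Category AlgebraicGeometry

namespace Summit.Ventures.HSemireg

open Literature.AlgebraicGeometry.Modules Literature.AlgebraicGeometry.Motives
open Literature.AlgebraicGeometry.HodgeTheory

namespace HomComplex

/-! ## §1 Window independence of the unit and of `σ_q` -/

section Window

universe w

variable (Y : Scheme.{w}) (E : CochainComplex Y.Modules ℤ)

/-- A unit summand `𝒪 ⟶ 𝓔nd(E^{-i}) ⟶ 𝓗om•(E•, E•)^0` vanishes when `E^{-i} = 0`. [folklore] -/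
theorem unitSummand_eq_zero_of_isZero (i : ℤ) (h : IsZero (E.X (-i))) : unitSummand Y E i = 0 := by
  change sheafHomUnit (E.X (-i)) ≫ ι Y E E (-i) i 0 _ = 0
  rw [(isZero_sheafHom_of_isZero h (E.X (-i))).eq_of_tgt (sheafHomUnit (E.X (-i))) 0, zero_comp]

/-- The degree-`0` unit over a larger window equals the one over `[a, b] ∋ supp E•`. [folklore] -/
theorem unitDeg₀_eq_of_le (a b a' b' : ℤ) (ha : a' ≤ a) (hb : b ≤ b') [E.IsStrictlyGE a] [E.IsStrictlyLE b] :
    unitDeg₀ Y E a' b' = unitDeg₀ Y E a b := by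
  unfold unitDeg₀
  symm
  refine Finset.sum_subset (Finset.Icc_subset_Icc (by lia) (by lia)) fun j hj hj' => ?_
  simp only [Finset.mem_Icc, not_and_or, not_le] at hj hj'
  rcases hj' with hj' | hj'
  · exact unitSummand_eq_zero_of_isZero Y E j (E.isZero_of_isStrictlyLE b _ (by lia))
  · exact unitSummand_eq_zero_of_isZero Y E j (E.isZero_of_isStrictlyGE a _ (by lia))

/-- The unit over a larger window equals the one over `[a, b]`. [folklore] -/
theorem unit_eq_of_le (a b a' b' : ℤ) (ha : a' ≤ a) (hb : b ≤ b') [E.IsStrictlyGE a] [E.IsStrictlyLE b]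
    [E.IsStrictlyGE a'] [E.IsStrictlyLE b'] : unit Y E a' b' = unit Y E a b := by
  refine HomologicalComplex.from_single_hom_ext ?_
  rw [unit, unit, HomologicalComplex.mkHomFromSingle_f, HomologicalComplex.mkHomFromSingle_f,
    unitDeg₀_eq_of_le Y E a b a' b' ha hb]

/-- **The unit `𝒪_X[0] ⟶ 𝓗om•(E•, E•)` does not depend on the amplitude window.** [folklore] -/
theorem unit_eq_of_window (a b a' b' : ℤ) [E.IsStrictlyGE a] [E.IsStrictlyLE b] [E.IsStrictlyGE a'] [E.IsStrictlyLE b'] :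
    unit Y E a' b' = unit Y E a b := by
  haveI := E.isStrictlyGE_of_ge (min a a') a (min_le_left _ _)
  haveI := E.isStrictlyLE_of_le b (max b b') (le_max_left _ _)
  rw [← unit_eq_of_le Y E a b (min a a') (max b b') (min_le_left _ _) (le_max_left _ _),
    unit_eq_of_le Y E a' b' (min a a') (max b b') (min_le_right _ _) (le_max_right _ _)]

end Window

section SigmaWindow

universe w₁ u₁

variable {S : Type u₁} [CommRing S] (X : Over (Spec (CommRingCat.of S))) [HasDerivedCategory.{w₁} X.left.Modules]
  (K : CochainComplex X.left.Modules ℤ) (a b a' b' : ℤ)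
  [K.IsStrictlyGE a] [K.IsStrictlyLE b] [K.IsStrictlyGE a'] [K.IsStrictlyLE b']
  (hK : ∀ p, IsFiniteLocallyFree (K.X p))

/-- **`σ_q` does not depend on the amplitude window** chosen for the strictly perfect complex. [cite: BuchweitzFlenner2003, Def. 4.1] -/
theorem sigmaC_eq_of_window (q : ℕ) (x : ShiftedHom (DerivedCategory.Q.obj K) (DerivedCategory.Q.obj K) (2 : ℤ)) :
    sigmaC X K a' b' hK q x = sigmaC X K a b hK q x := by
  rw [sigmaC, sigmaC, unitQ, unitQ, unit_eq_of_window X.left K a b a' b']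
  rfl

/-- `I`-semiregularity does not depend on the amplitude window. [cite: BuchweitzFlenner2003, §5 (I-semiregular)] -/
theorem isISemiregularC_iff_of_window (I : Set ℕ) : IsISemiregularC X K a' b' hK I ↔ IsISemiregularC X K a b hK I := by
  have h : (fun (x : ShiftedHom (DerivedCategory.Q.obj K) (DerivedCategory.Q.obj K) (2 : ℤ)) (q : I) => sigmaC X K a' b' hK q x) =
      fun (x : ShiftedHom (DerivedCategory.Q.obj K) (DerivedCategory.Q.obj K) (2 : ℤ)) (q : I) => sigmaC X K a b hK q x := by
    funext x; funext q
    exact sigmaC_eq_of_window X K a b a' b' hK q x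
  rw [IsISemiregularC, IsISemiregularC, h]

/-- `q`-semiregularity does not depend on the amplitude window. [cite: BuchweitzFlenner2003, Def. 4.1] -/
theorem isSemiregularC_iff_of_window (q : ℕ) : IsSemiregularC X K a' b' hK q ↔ IsSemiregularC X K a b hK q := by
  rw [isSemiregularC_iff_isISemiregularC_singleton, isSemiregularC_iff_isISemiregularC_singleton]
  exact isISemiregularC_iff_of_window X K a b a' b' hK {q}

end SigmaWindow

/-! ## §2 Transport along quasi-isomorphisms, independent windows -/

section QuasiIsoWindows

universe w₁ u₁

variable {S : Type u₁} [CommRing S] (X : Over (Spec (CommRingCat.of S))) [HasDerivedCategory.{w₁} X.left.Modules]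
  {K₁ K₂ : CochainComplex X.left.Modules ℤ} (a₁ b₁ a₂ b₂ : ℤ)
  [K₁.IsStrictlyGE a₁] [K₁.IsStrictlyLE b₁] [K₂.IsStrictlyGE a₂] [K₂.IsStrictlyLE b₂]
  (hK₁ : ∀ p, IsFiniteLocallyFree (K₁.X p)) (hK₂ : ∀ p, IsFiniteLocallyFree (K₂.X p)) (f : K₁ ⟶ K₂) [QuasiIso f]

/-- `σ_q(K₁•)(x) = σ_q(K₂•)(x')` for classes intertwined by a quasi-isomorphism `f`, each complex in its own window.
[cite: BuchweitzFlenner2003, Def. 4.1] -/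
theorem sigmaC_eq_of_quasiIso' (q : ℕ) (x : ShiftedHom (DerivedCategory.Q.obj K₁) (DerivedCategory.Q.obj K₁) (2 : ℤ))
    (x' : ShiftedHom (DerivedCategory.Q.obj K₂) (DerivedCategory.Q.obj K₂) (2 : ℤ))
    (h : x.comp (ShiftedHom.mk₀ (0 : ℤ) rfl (DerivedCategory.Q.map f)) (zero_add 2) =
      (ShiftedHom.mk₀ (0 : ℤ) rfl (DerivedCategory.Q.map f)).comp x' (add_zero 2)) :
    sigmaC X K₁ a₁ b₁ hK₁ q x = sigmaC X K₂ a₂ b₂ hK₂ q x' := by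
  haveI := K₁.isStrictlyGE_of_ge (min a₁ a₂) a₁ (min_le_left _ _)
  haveI := K₁.isStrictlyLE_of_le b₁ (max b₁ b₂) (le_max_left _ _)
  haveI := K₂.isStrictlyGE_of_ge (min a₁ a₂) a₂ (min_le_right _ _)
  haveI := K₂.isStrictlyLE_of_le b₂ (max b₁ b₂) (le_max_right _ _)
  rw [sigmaC_eq_of_window X K₁ (min a₁ a₂) (max b₁ b₂) a₁ b₁ hK₁,
    sigmaC_eq_of_window X K₂ (min a₁ a₂) (max b₁ b₂) a₂ b₂ hK₂]
  exact sigmaC_eq_of_quasiIso X (min a₁ a₂) (max b₁ b₂) hK₁ hK₂ f q x x' h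

include f in
/-- **`I`-semiregularity is transported along a quasi-isomorphism of strictly perfect models** (each in its own window).
[cite: BuchweitzFlenner2003, §5 (I-semiregular)] -/
theorem isISemiregularC_iff_of_quasiIso' (I : Set ℕ) : IsISemiregularC X K₁ a₁ b₁ hK₁ I ↔ IsISemiregularC X K₂ a₂ b₂ hK₂ I := by
  haveI := K₁.isStrictlyGE_of_ge (min a₁ a₂) a₁ (min_le_left _ _)
  haveI := K₁.isStrictlyLE_of_le b₁ (max b₁ b₂) (le_max_left _ _)
  haveI := K₂.isStrictlyGE_of_ge (min a₁ a₂) a₂ (min_le_right _ _)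
  haveI := K₂.isStrictlyLE_of_le b₂ (max b₁ b₂) (le_max_right _ _)
  rw [isISemiregularC_iff_of_window X K₁ (min a₁ a₂) (max b₁ b₂) a₁ b₁ hK₁,
    isISemiregularC_iff_of_window X K₂ (min a₁ a₂) (max b₁ b₂) a₂ b₂ hK₂]
  exact isISemiregularC_iff_of_quasiIso X (min a₁ a₂) (max b₁ b₂) hK₁ hK₂ f I

include f in
/-- `q`-semiregularity is transported along a quasi-isomorphism of strictly perfect models (each in its own window).
[cite: BuchweitzFlenner2003, Def. 4.1] -/
theorem isSemiregularC_iff_of_quasiIso' (q : ℕ) : IsSemiregularC X K₁ a₁ b₁ hK₁ q ↔ IsSemiregularC X K₂ a₂ b₂ hK₂ q := by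
  rw [isSemiregularC_iff_isISemiregularC_singleton, isSemiregularC_iff_isISemiregularC_singleton]
  exact isISemiregularC_iff_of_quasiIso' X a₁ b₁ a₂ b₂ hK₁ hK₂ f {q}

end QuasiIsoWindows

end HomComplex


/-! ## §3 The σ-admissibility notion along quasi-isomorphisms of strictly perfect complexes (cf. p4's `rankAdmissible` analogue) -/

section Door

variable {n : ℕ} {X₀ : SchemeOver ℂ} {I : Finset ℕ} {E E' : CochainComplex X₀.left.Modules ℤ}

/-- **The σ-admissibility notion is model-independent along quasi-isomorphisms of strictly perfect complexes**: for a
quasi-isomorphism `f : E ⟶ E'` with `E ∈ [a, b]`, `E' ∈ [a', b']` termwise finite locally free, `E` is σ-admissible for `(n, X₀, I)` iff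
`E'` is (`{1..n} ⊆ I` is common; `Ext^{<0} = 0`, `Hom = ℂ` by p4's `extRank_eq_of_quasiIso`; the joint injectivity of `(σ_q)_{q+1 ∈ I}` by
`isISemiregularC_iff_of_quasiIso'`). [cite: BuchweitzFlenner2003, §5 (I-semiregular)] -/
theorem sigmaAdmissible_iff_of_quasiIso (f : E ⟶ E') [QuasiIso f] (a b a' b' : ℤ) [E.IsStrictlyGE a] [E.IsStrictlyLE b]
    [E'.IsStrictlyGE a'] [E'.IsStrictlyLE b'] (hE : ∀ i, IsFiniteLocallyFree (E.X i)) (hE' : ∀ i, IsFiniteLocallyFree (E'.X i)) :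
    sigmaAdmissible n X₀ I E ↔ sigmaAdmissible n X₀ I E' := by
  letI := HasDerivedCategory.standard X₀.left.Modules
  simp only [sigmaAdmissible, extRank_eq_of_quasiIso X₀ f]
  refine and_congr_right fun _ => and_congr_right fun _ => and_congr_right fun _ => ⟨?_, ?_⟩
  · rintro ⟨a₀, b₀, _, _, hE₀, h⟩
    exact ⟨a', b', inferInstance, inferInstance, hE',
      (HomComplex.isISemiregularC_iff_of_quasiIso' X₀ a₀ b₀ a' b' hE₀ hE' f _).1 h⟩
  · rintro ⟨a₀, b₀, _, _, hE₀, h⟩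
    exact ⟨a, b, inferInstance, inferInstance, hE,
      (HomComplex.isISemiregularC_iff_of_quasiIso' X₀ a b a₀ b₀ hE hE₀ f _).2 h⟩

/-- **Model independence of σ-admissibility along a roof** `E ⟵ E₃ ⟶ E'` of quasi-isomorphisms of strictly perfect complexes.
[cite: BuchweitzFlenner2003, §5 (I-semiregular)] -/
theorem sigmaAdmissible_iff_of_roof {E₃ : CochainComplex X₀.left.Modules ℤ} (g : E₃ ⟶ E) (g' : E₃ ⟶ E') [QuasiIso g] [QuasiIso g']
    (a b a' b' a₃ b₃ : ℤ) [E.IsStrictlyGE a] [E.IsStrictlyLE b] [E'.IsStrictlyGE a'] [E'.IsStrictlyLE b'] [E₃.IsStrictlyGE a₃]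
    [E₃.IsStrictlyLE b₃] (hE : ∀ i, IsFiniteLocallyFree (E.X i)) (hE' : ∀ i, IsFiniteLocallyFree (E'.X i))
    (hE₃ : ∀ i, IsFiniteLocallyFree (E₃.X i)) : sigmaAdmissible n X₀ I E ↔ sigmaAdmissible n X₀ I E' :=
  (sigmaAdmissible_iff_of_quasiIso g a₃ b₃ a b hE₃ hE).symm.trans (sigmaAdmissible_iff_of_quasiIso g' a₃ b₃ a' b' hE₃ hE')

end Door

end Summit.Ventures.HSemireg

end
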